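import Summits.RiemannHypothesis.RiemannHypothesis.Theses.LeeYang
import Literature.Probability.LatticeModels.LeeYangProofs
import HarnessLib

/-!
# RiemannHypothesis / LeeYang — support item `LeeYangCircleTheoremFinite`

Route `RiemannHypothesis/LeeYang`, item `stmt-RiemannHypothesis-0455` (`LeeYangCircleTheoremFinite`):
the Lee–Yang circle theorem for finite spin-½ ferromagnets — for `n` sites, couplings `J i j ≥ 0`
and complex fields with `0 < Re (h i)`, the Ising partition function
`∑_{σ : Fin n → Bool} exp (∑ᵢ ∑ⱼ Jᵢⱼ [σᵢ = σⱼ ? 1 : −1] + ∑ᵢ hᵢ [σᵢ ? 1 : −1])` is non-zero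
(Lee–Yang 1952, App. II; Asano 1970).

The route decl is verbatim the Literature named fact
`Literature.Probability.LatticeModels.lee_yang_circle_theorem_finite`, which is discharged in the
tree by `Literature.Probability.LatticeModels.lee_yang_circle_theorem_finite_holds`
(`LeeYangProofs.lean`, Asano contractions following Friedli–Velenik 2017 §3.7.4). This file is the
one-line transport.
-/

-- D-0017: a single-problem summit has `RiemannHypothesis.RiemannHypothesis` in every name by
-- design; the lakefile turns this linter off for `Summits`; repeated here so that standalone
-- elaboration is warning-free as well.
set_option linter.dupNamespace false

namespace Summit.RiemannHypothesis.RiemannHypothesis.Theorems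

/-- The route item `LeeYangCircleTheoremFinite` of `RiemannHypothesis/LeeYang` holds: it is
definitionally the tree theorem
`Literature.Probability.LatticeModels.lee_yang_circle_theorem_finite_holds` (Lee–Yang circle
theorem for finite spin-½ ferromagnets with fields in the open right half plane). -/
theorem leeYangCircleTheoremFinite_proof :
    Summit.RiemannHypothesis.RiemannHypothesis.Theses.LeeYang.LeeYangCircleTheoremFinite := by
  unfold Summit.RiemannHypothesis.RiemannHypothesis.Theses.LeeYang.LeeYangCircleTheoremFinite
  exact Literature.Probability.LatticeModels.lee_yang_circle_theorem_finite_holds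

end Summit.RiemannHypothesis.RiemannHypothesis.Theorems
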